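import Summits.BirchSwinnertonDyer.BirchSwinnertonDyer.Theorems.ManinLocalTwoThreeTameThreeNeronScalarIIIstar
import Literature.NumberTheory.DiophantineGeometry.TameAdditiveTypesAtTwoProofs
import Literature.NumberTheory.DiophantineGeometry.TateAlgorithmTameTypesOddProofs
import Literature.NumberTheory.EllipticCurves.NeronComponentIndexProofs
import Literature.NumberTheory.EllipticCurves.NeronComponentIndexTypeIVProofs
import Literature.NumberTheory.EllipticCurves.NeronComponentIndexTypeIVstarProofs
import HarnessLib

/-!
# The additive types with `f = 2` in residue characteristic `3` are `III`, `III*` and `Iₙ*`: types `II`, `IV`, `IV*`, `II*`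
# are WILD at `3` (`f ≥ 3`); over `ℚ`: `9 ∥ N` ⟹ `ord₃ Δ_min ∈ {3, 9, 6 + n}`, and `∈ {3, 6, 9}` if `ord₃ j ≥ 0`

Summit `BirchSwinnertonDyer`, route `ManinLocalTwoThree` (cell bsd-f2-manin), deciding crux C3 `ManinPrimeToThreeAtNine`
(stmt-BirchSwinnertonDyer-22968): the STRATIFICATION of the tame cell at `3` used throughout the cell (an's MEMO-an §66–§67:
«tame at `3` = `III`, `I₀*`, `III*` (+ pot. multiplicative `Iₙ*`)») as a theorem.  The tree DEFINES `f_v` by Ogg's formula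
`f_v = ord_v(Δ_min) + 1 − m_v` (`WeierstrassCurve.conductorExponent`); `…TateAlgorithmTameTypesOddProofs` gives `ord Δ = m + 1` (so
`f = 2`) for `III`, `III*`, `Iₙ*` when `2` is a unit; this file supplies the converse at residue characteristic `3`: on the
normal forms of Tate's algorithm (`kodairaSymbolOfMinimal_eq_II_imp` + Step 2: `π ∣ a₃, a₄, a₆`, `π ∣ b₂`;
`exists_smul_of_kodairaSymbolOfMinimal_eq_IV`: `π ∣ a₁, a₂, a₃`, `π² ∣ a₄, a₆`; `…_eq_IVstar`: `π ∣ a₁`, `π² ∣ a₂, a₃`, `π³ ∣ a₄`,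
`π⁴ ∣ a₆`; `…_eq_IIstar`: `π ∣ a₁`, `π² ∣ a₂`, `π³ ∣ a₃`, `π⁴ ∣ a₄`, `π⁵ ∣ a₆`) the literal coefficients `27 ∈ 𝔪³`, `9 ∈ 𝔪²` of
`Δ = −b₂²b₈ − 8b₄³ − 27b₆² + 9b₂b₄b₆` give `ord Δ ≥ 3, 5, 9, 11` respectively, i.e. `f = ord Δ + 1 − m ≥ 3` (`m = 1, 3, 7, 9`).

* §1 `Δ_mem_pow_of_b_of_three_mem`, `Δ_mem_pow_of_a_of_three_mem` — orders of `Δ` from orders of the `bᵢ` / `aᵢ` when `3 ∈ I`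
  (the `bᵢ` orders are the tree's `OggBound.b₂_mem_pow` &c.).
* §2 `Δ_mem_pow_of_kodairaSymbolOfMinimal_eq_{II,IV,IVstar,IIstar}_of_three_mem` (DVR, perfect residue field, `3 ∈ 𝔪`).
* §3 `three_le_conductorExponent_of_kodairaSymbolAt_eq_{II,IV,IVstar,IIstar}_of_three_mem` and the classification
  `kodairaSymbolAt_of_conductorExponent_eq_two_of_three_mem`: `f_v = 2`, `3 ∈ 𝔪_v` ⟹ type `III`, `III*` or `Iₙ*`.
* §4 over `ℚ`: `kodairaSymbolAt_placeOf_three_of_nine_dvd_conductorNorm` (`9 ∥ N` ⟹ `III ∧ ord₃Δ = 3`, `III* ∧ 9`, or `Iₙ* ∧ n + 6`),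
  `padicValInt_three_minimalDiscriminantInt_of_nine_dvd_conductorNorm_of_j` (`9 ∥ N`, `ord₃ j ≥ 0` ⟹ `ord₃ Δ_min ∈ {3, 6, 9}` with the
  types `III`, `I₀*`, `III*`).

HONEST FRAMING: local structure theorems; C3, Manin's conjecture and BSD are not proved.  No definitions, no named facts, no sorry.
References: [SilvermanATAEC1994] IV.9.4 Steps 3–10 and Table 4.1, IV.11.1; [Papadopoulos1993] Table II (p = 3); [Kraus1990] p = 3.
-/

set_option linter.dupNamespace false
set_option autoImplicit false

noncomputable section

open scoped Classical

open WeierstrassCurve IsDedekindDomain IsLocalRing Polynomial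
  Literature.NumberTheory.DiophantineGeometry Literature.NumberTheory.DiophantineGeometry.TateAlgorithm
  Literature.NumberTheory.DiophantineGeometry.TateAlgorithm.OggBound
  Literature.NumberTheory.EllipticCurves Literature.NumberTheory.EllipticCurves.LocalIndex
open IsDiscreteValuationRing hiding maximalIdeal

namespace Summit.BirchSwinnertonDyer.BirchSwinnertonDyer.Theorems.ManinLocalTwoThree

/-! ### §1 Orders of the `bᵢ` and of `Δ` when `3 ∈ I` -/

section IdealPow

variable {S : Type*} [CommRing S] {I : Ideal S} (W : WeierstrassCurve S)

/-- Order of `Δ = −b₂²b₈ − 8b₄³ − 27b₆² + 9b₂b₄b₆` when `3 ∈ I` (so `27 ∈ I³`, `9 ∈ I²`). [folklore] -/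
theorem Δ_mem_pow_of_b_of_three_mem (h3 : (3 : S) ∈ I) {e₂ e₄ e₆ e₈ N : ℕ} (hb2 : W.b₂ ∈ I ^ e₂)
    (hb4 : W.b₄ ∈ I ^ e₄) (hb6 : W.b₆ ∈ I ^ e₆) (hb8 : W.b₈ ∈ I ^ e₈)
    (hN1 : N ≤ e₂ + e₂ + e₈ := by omega) (hN2 : N ≤ e₄ + e₄ + e₄ := by omega)
    (hN3 : N ≤ 3 + (e₆ + e₆) := by omega) (hN4 : N ≤ 2 + (e₂ + e₄ + e₆) := by omega) : W.Δ ∈ I ^ N := by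
  have h27 : (27 : S) ∈ I ^ 3 := by
    rw [show (27 : S) = 3 * 3 * 3 by norm_num, show (3 : ℕ) = 1 + 1 + 1 from rfl, pow_add, pow_add, pow_one]
    exact Ideal.mul_mem_mul (Ideal.mul_mem_mul h3 h3) h3
  have h9 : (9 : S) ∈ I ^ 2 := by
    rw [show (9 : S) = 3 * 3 by norm_num, pow_two]; exact Ideal.mul_mem_mul h3 h3
  have eq : W.Δ = -(W.b₂ * W.b₂ * W.b₈) - 8 * (W.b₄ * W.b₄ * W.b₄) - 27 * (W.b₆ * W.b₆) +
      9 * (W.b₂ * W.b₄ * W.b₆) := by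
    rw [WeierstrassCurve.Δ]; ring
  rw [eq]
  refine add_mem (sub_mem (sub_mem ?_ ?_) ?_) ?_
  · exact neg_mem (Ideal.pow_le_pow_right hN1 (mul_mem_pow_add (mul_mem_pow_add hb2 hb2) hb8))
  · exact Ideal.mul_mem_left _ _ (Ideal.pow_le_pow_right hN2 (mul_mem_pow_add (mul_mem_pow_add hb4 hb4) hb4))
  · exact Ideal.pow_le_pow_right hN3 (mul_mem_pow_add h27 (mul_mem_pow_add hb6 hb6))
  · exact Ideal.pow_le_pow_right hN4 (mul_mem_pow_add h9 (mul_mem_pow_add (mul_mem_pow_add hb2 hb4) hb6))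

/-- Order of `Δ` from orders of the `aᵢ` when `3 ∈ I`, through chosen orders `eᵢ` of the `bᵢ`. [folklore] -/
theorem Δ_mem_pow_of_a_of_three_mem (h3 : (3 : S) ∈ I) {n₁ n₂ n₃ n₄ n₆ : ℕ} (e₂ e₄ e₆ e₈ : ℕ) {N : ℕ}
    (h1 : W.a₁ ∈ I ^ n₁) (h₂ : W.a₂ ∈ I ^ n₂) (h3' : W.a₃ ∈ I ^ n₃) (h4 : W.a₄ ∈ I ^ n₄) (h6 : W.a₆ ∈ I ^ n₆)
    (i1 : e₂ ≤ n₁ + n₁ := by omega) (i2 : e₂ ≤ n₂ := by omega)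
    (i3 : e₄ ≤ n₄ := by omega) (i4 : e₄ ≤ n₁ + n₃ := by omega)
    (i5 : e₆ ≤ n₃ + n₃ := by omega) (i6 : e₆ ≤ n₆ := by omega)
    (i7 : e₈ ≤ n₁ + n₁ + n₆ := by omega) (i8 : e₈ ≤ n₂ + n₆ := by omega)
    (i9 : e₈ ≤ n₁ + n₃ + n₄ := by omega) (i10 : e₈ ≤ n₂ + n₃ + n₃ := by omega) (i11 : e₈ ≤ n₄ + n₄ := by omega)
    (hN1 : N ≤ e₂ + e₂ + e₈ := by omega) (hN2 : N ≤ e₄ + e₄ + e₄ := by omega)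
    (hN3 : N ≤ 3 + (e₆ + e₆) := by omega) (hN4 : N ≤ 2 + (e₂ + e₄ + e₆) := by omega) : W.Δ ∈ I ^ N :=
  Δ_mem_pow_of_b_of_three_mem W h3 (b₂_mem_pow W h1 h₂ i1 i2) (b₄_mem_pow W h1 h3' h4 i3 i4)
    (b₆_mem_pow W h3' h6 i5 i6) (b₈_mem_pow W h1 h₂ h3' h4 h6 i7 i8 i9 i10 i11) hN1 hN2 hN3 hN4

/-- `Δ(V) ∈ J ⟺ Δ(D • V) ∈ J` for a change of variables over the ring (unit `u`). [folklore] -/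
theorem Δ_mem_of_smul_Δ_mem {J : Ideal S} (D : VariableChange S) (h : (D • W).Δ ∈ J) : W.Δ ∈ J := by
  have e : W.Δ = (D.u : S) ^ 12 * (D • W).Δ := by
    rw [variableChange_Δ, ← mul_assoc, ← mul_pow, Units.mul_inv, one_pow, one_mul]
  rw [e]; exact Ideal.mul_mem_left _ _ h

end IdealPow

/-! ### §2 Types `II`, `IV`, `IV*`, `II*` in residue characteristic `3`: `ord Δ ≥ m + 2` -/

section DVR

variable {R : Type*} [CommRing R] [IsDomain R] [IsDiscreteValuationRing R]

/-- `x ∈ 𝔪 ^ 0`. -/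
private theorem mem_pow_zero (x : R) : x ∈ maximalIdeal R ^ 0 := by
  rw [pow_zero, Ideal.one_eq_top]; exact Submodule.mem_top

/-- **Type `II` in residue characteristic `3`: `π³ ∣ Δ`.**  Step-2 model: `π ∣ a₃, a₄, a₆`, `π ∣ b₂`, hence `π ∣ b₄, b₆, b₈`.
[cite: SilvermanATAEC1994, IV.9.4 Step 3] -/
theorem Δ_mem_pow_of_kodairaSymbolOfMinimal_eq_II_of_three_mem [PerfectField (ResidueField R)]
    (h3 : (3 : R) ∈ maximalIdeal R) (V : WeierstrassCurve R) (hV : V.kodairaSymbolOfMinimal = .II) :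
    V.Δ ∈ maximalIdeal R ^ 3 := by
  obtain ⟨hΔm, hb₂, -⟩ := kodairaSymbolOfMinimal_eq_II_imp V hV
  have hex2 := exists_variableChange_step2_of_perfectField V hΔm
  have hN2 : normalizeStep2 V = hex2.choose • V := dif_pos hex2
  obtain ⟨hu, hA₃, hA₄, hA₆⟩ := hex2.choose_spec
  rw [hN2] at hb₂
  set N := hex2.choose • V with hN
  have hΔ : V.Δ = N.Δ := (Δ_smul_of_u_eq_one hu V).symm
  rw [hΔ]
  have h1 := mem_pow_zero N.a₁
  have h2 := mem_pow_zero N.a₂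
  rw [← pow_one (maximalIdeal R)] at hA₃ hA₄ hA₆ hb₂
  exact Δ_mem_pow_of_b_of_three_mem N h3 hb₂ (b₄_mem_pow N h1 hA₃ hA₄ (e := 1))
    (b₆_mem_pow N hA₃ hA₆ (e := 1)) (b₈_mem_pow N h1 h2 hA₃ hA₄ hA₆ (e := 1))

/-- **Type `IV` in residue characteristic `3`: `π⁵ ∣ Δ`.**  Normal form `π ∣ a₁, a₂, a₃`, `π² ∣ a₄, a₆`: `ord b₂ ≥ 1`, `ord b₄ ≥ 2`,
`ord b₆ ≥ 2`, `ord b₈ ≥ 3`. [cite: SilvermanATAEC1994, IV.9.4 Step 5] -/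
theorem Δ_mem_pow_of_kodairaSymbolOfMinimal_eq_IV_of_three_mem [PerfectField (ResidueField R)]
    (h3 : (3 : R) ∈ maximalIdeal R) (V : WeierstrassCurve R) (hV : V.kodairaSymbolOfMinimal = .IV) :
    V.Δ ∈ maximalIdeal R ^ 5 := by
  obtain ⟨D, h1, h2, h3', h4, h6, -⟩ := exists_smul_of_kodairaSymbolOfMinimal_eq_IV V hV
  rw [← pow_one (maximalIdeal R)] at h1 h2 h3'
  exact Δ_mem_of_smul_Δ_mem V D (Δ_mem_pow_of_a_of_three_mem (D • V) h3 1 2 2 3 h1 h2 h3' h4 h6)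

/-- **Type `IV*` in residue characteristic `3`: `π⁹ ∣ Δ`.**  Normal form `π ∣ a₁`, `π² ∣ a₂, a₃`, `π³ ∣ a₄`, `π⁴ ∣ a₆`.
[cite: SilvermanATAEC1994, IV.9.4 Step 8] -/
theorem Δ_mem_pow_of_kodairaSymbolOfMinimal_eq_IVstar_of_three_mem [PerfectField (ResidueField R)]
    (h3 : (3 : R) ∈ maximalIdeal R) (V : WeierstrassCurve R) (hV : V.kodairaSymbolOfMinimal = .IVstar) :
    V.Δ ∈ maximalIdeal R ^ 9 := by
  obtain ⟨D, h1, h2, h3', h4, h6, -⟩ := exists_smul_of_kodairaSymbolOfMinimal_eq_IVstar V hV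
  rw [← pow_one (maximalIdeal R)] at h1
  exact Δ_mem_of_smul_Δ_mem V D (Δ_mem_pow_of_a_of_three_mem (D • V) h3 2 3 4 6 h1 h2 h3' h4 h6)

/-- **Type `II*` in residue characteristic `3`: `π¹¹ ∣ Δ`.**  Step-10 model `π ∣ a₁`, `π² ∣ a₂`, `π³ ∣ a₃`, `π⁴ ∣ a₄`, `π⁵ ∣ a₆`.
[cite: SilvermanATAEC1994, IV.9.4 Step 10] -/
theorem Δ_mem_pow_of_kodairaSymbolOfMinimal_eq_IIstar_of_three_mem [PerfectField (ResidueField R)]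
    (h3 : (3 : R) ∈ maximalIdeal R) (V : WeierstrassCurve R) (hV : V.kodairaSymbolOfMinimal = .IIstar) :
    V.Δ ∈ maximalIdeal R ^ 11 := by
  obtain ⟨D, h1, h2, h3', h4, h6, -⟩ := exists_smul_of_kodairaSymbolOfMinimal_eq_IIstar V hV
  rw [← pow_one (maximalIdeal R)] at h1
  exact Δ_mem_of_smul_Δ_mem V D (Δ_mem_pow_of_a_of_three_mem (D • V) h3 2 4 5 7 h1 h2 h3' h4 h6)

/-- The four together as a lower bound on `ord Δ`: `m + 2 ≤ ord Δ` for `II`, `IV`, `IV*`, `II*` when `3 ∈ 𝔪`.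
[cite: SilvermanATAEC1994, IV.9.4 and Table 4.1] -/
theorem numComponents_add_two_le_addVal_Δ_toNat_of_three_mem [PerfectField (ResidueField R)]
    (h3 : (3 : R) ∈ maximalIdeal R) (V : WeierstrassCurve R) (hΔ0 : V.Δ ≠ 0)
    (hV : V.kodairaSymbolOfMinimal = .II ∨ V.kodairaSymbolOfMinimal = .IV ∨ V.kodairaSymbolOfMinimal = .IVstar ∨
      V.kodairaSymbolOfMinimal = .IIstar) :
    V.kodairaSymbolOfMinimal.numComponents + 2 ≤ (addVal R V.Δ).toNat := by
  have hϖ : Irreducible (uniformizer R) := irreducible_uniformizer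
  rcases hV with h | h | h | h <;> rw [h]
  · exact le_addVal_toNat_of_pow_dvd hϖ hΔ0
      (mem_maximalIdeal_pow_iff_dvd.mp (Δ_mem_pow_of_kodairaSymbolOfMinimal_eq_II_of_three_mem h3 V h))
  · exact le_addVal_toNat_of_pow_dvd hϖ hΔ0
      (mem_maximalIdeal_pow_iff_dvd.mp (Δ_mem_pow_of_kodairaSymbolOfMinimal_eq_IV_of_three_mem h3 V h))
  · exact le_addVal_toNat_of_pow_dvd hϖ hΔ0
      (mem_maximalIdeal_pow_iff_dvd.mp (Δ_mem_pow_of_kodairaSymbolOfMinimal_eq_IVstar_of_three_mem h3 V h))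
  · exact le_addVal_toNat_of_pow_dvd hϖ hΔ0
      (mem_maximalIdeal_pow_iff_dvd.mp (Δ_mem_pow_of_kodairaSymbolOfMinimal_eq_IIstar_of_three_mem h3 V h))

end DVR


/-! ### §3 At a place of residue characteristic `3`: `II`, `IV`, `IV*`, `II*` are wild; `f = 2` forces `III`, `III*`, `Iₙ*` -/

section Local

variable {A : Type*} [CommRing A] [IsDedekindDomain A] {K : Type*} [Field K] [Algebra A K] [IsFractionRing A K]
  (v : HeightOneSpectrum A) (W : WeierstrassCurve K)

/-- **Types `II`, `IV`, `IV*`, `II*` are WILD in residue characteristic `3`: `f_v ≥ 3`** (elliptic `W`, perfect residue field of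
`O_v`, `3 ∈ 𝔪_v`; Ogg's formula `f_v = ord_v(Δ_min) + 1 − m_v` being the definition of `conductorExponent`, with
`ord_v(Δ_min) ≥ m_v + 2`). [cite: SilvermanATAEC1994, IV.9.4 and Table 4.1] [cite: Papadopoulos1993, Table II (p = 3)] -/
theorem three_le_conductorExponent_of_kodairaSymbolAt_of_three_mem [W.IsElliptic]
    [PerfectField (IsLocalRing.ResidueField (v.adicCompletionIntegers K))]
    (h3 : (3 : v.adicCompletionIntegers K) ∈ IsLocalRing.maximalIdeal _)
    (hT : W.kodairaSymbolAt v = .II ∨ W.kodairaSymbolAt v = .IV ∨ W.kodairaSymbolAt v = .IVstar ∨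
      W.kodairaSymbolAt v = .IIstar) :
    3 ≤ W.conductorExponent v := by
  rw [kodairaSymbolAt_def] at hT
  have h := numComponents_add_two_le_addVal_Δ_toNat_of_three_mem h3 _ (localMinimalIntegralModel_Δ_ne_zero v W) hT
  have h' : (W.localMinimalIntegralModel v).kodairaSymbolOfMinimal.numComponents + 2 ≤ W.ordMinimalDiscriminant v := h
  unfold conductorExponent numComponentsAt
  rw [kodairaSymbolAt_def]
  omega

/-- **The additive types with `f_v = 2` in residue characteristic `3` are `III`, `III*` and `Iₙ*` (`n ≥ 0`).**  `f_v = 2` makes the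
reduction additive (`two_le_conductorExponent_iff_holds`, `isAdditive_kodairaSymbolAt_iff_holds`); `II`, `IV`, `IV*`, `II*` have
`f_v ≥ 3`. [cite: SilvermanATAEC1994, IV.9.4 and Table 4.1] [cite: Papadopoulos1993, Table II (p = 3)] -/
theorem kodairaSymbolAt_of_conductorExponent_eq_two_of_three_mem [W.IsElliptic]
    [PerfectField (IsLocalRing.ResidueField (v.adicCompletionIntegers K))]
    (h3 : (3 : v.adicCompletionIntegers K) ∈ IsLocalRing.maximalIdeal _) (hf : W.conductorExponent v = 2) :
    W.kodairaSymbolAt v = .III ∨ W.kodairaSymbolAt v = .IIIstar ∨ ∃ n, W.kodairaSymbolAt v = .Istar n := by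
  have hadd : (W.kodairaSymbolAt v).IsAdditive :=
    (isAdditive_kodairaSymbolAt_iff_holds v W).mpr ((two_le_conductorExponent_iff_holds v W).mp (by omega))
  have hwild : (W.kodairaSymbolAt v = .II ∨ W.kodairaSymbolAt v = .IV ∨ W.kodairaSymbolAt v = .IVstar ∨
      W.kodairaSymbolAt v = .IIstar) → False := fun hT ↦ by
    have := three_le_conductorExponent_of_kodairaSymbolAt_of_three_mem v W h3 hT
    omega
  generalize hT : W.kodairaSymbolAt v = T at hadd hwild
  cases T with
  | I n => exact absurd hadd (KodairaSymbol.not_isAdditive_I n)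
  | II => exact (hwild (Or.inl rfl)).elim
  | III => exact Or.inl rfl
  | IV => exact (hwild (Or.inr (Or.inl rfl))).elim
  | Istar n => exact Or.inr (Or.inr ⟨n, rfl⟩)
  | IVstar => exact (hwild (Or.inr (Or.inr (Or.inl rfl)))).elim
  | IIIstar => exact Or.inr (Or.inl rfl)
  | IIstar => exact (hwild (Or.inr (Or.inr (Or.inr rfl)))).elim

end Local

/-! ### §4 Over `ℚ` at `3`: `9 ∥ N` ⟹ `III` (`ord₃ Δ_min = 3`), `III*` (`9`) or `Iₙ*` (`n + 6`); `∈ {3, 6, 9}` when `ord₃ j ≥ 0` -/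

section Rat

open NumberField Rat.HeightOneSpectrum Summit.BirchSwinnertonDyer.Rank1Residual.Additive

/-- `3` lies in the maximal ideal of `O_v ≃ ℤ₃` at the place `placeOf 3` of `ℤ`. [folklore] -/
theorem three_mem_maximalIdeal_adicCompletionIntegers_placeOf_three :
    (3 : (placeOf 3).adicCompletionIntegers ℚ) ∈ IsLocalRing.maximalIdeal _ := by
  have hgen : natGenerator (placeOf 3) = 3 :=
    congrArg Subtype.val ((primesEquiv (R := ℤ)).apply_symm_apply ⟨3, Nat.prime_three⟩)
  have h := Literature.NumberTheory.DiophantineGeometry.Rat.irreducible_natCast_natGenerator (placeOf 3)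
  rw [hgen] at h
  have h' : Irreducible (3 : (placeOf 3).adicCompletionIntegers ℚ) := by simpa using h
  exact (IsLocalRing.mem_maximalIdeal _).mpr h'.not_isUnit

/-- **`9 ∥ N` over `ℚ`: the Kodaira type at `3` is `III` with `ord₃ Δ_min = 3`, `III*` with `ord₃ Δ_min = 9`, or `Iₙ*` with
`ord₃ Δ_min = n + 6`** (`f₃ = 2` by `factorization_conductorNorm`; the classification of §3; `ord Δ = m + 1` on the tame types,
`…TateAlgorithmTameTypesOddProofs`). [cite: SilvermanATAEC1994, IV.9.4 Table 4.1 and IV.11.1] [cite: Papadopoulos1993, Table II (p = 3)] -/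
theorem kodairaSymbolAt_placeOf_three_of_nine_dvd_conductorNorm (W : WeierstrassCurve ℚ) [W.IsElliptic]
    (h9 : 3 ^ 2 ∣ W.conductorNorm ℤ) (h27 : ¬ 3 ^ 3 ∣ W.conductorNorm ℤ) :
    (W.kodairaSymbolAt (placeOf 3) = .III ∧ W.ordMinimalDiscriminant (placeOf 3) = 3) ∨
      (W.kodairaSymbolAt (placeOf 3) = .IIIstar ∧ W.ordMinimalDiscriminant (placeOf 3) = 9) ∨
      ∃ n, W.kodairaSymbolAt (placeOf 3) = .Istar n ∧ W.ordMinimalDiscriminant (placeOf 3) = n + 6 := by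
  haveI : PerfectField (IsLocalRing.ResidueField ((placeOf 3).adicCompletionIntegers ℚ)) := PerfectField.ofFinite
  have hN0 : W.conductorNorm ℤ ≠ 0 := fun h ↦ h27 (h ▸ dvd_zero _)
  have hf : (W.conductorNorm ℤ).factorization 3 = 2 := by
    have h2 : 2 ≤ (W.conductorNorm ℤ).factorization 3 := (Nat.prime_three.pow_dvd_iff_le_factorization hN0).mp h9
    have h3 : ¬ 3 ≤ (W.conductorNorm ℤ).factorization 3 := fun h ↦
      h27 ((Nat.prime_three.pow_dvd_iff_le_factorization hN0).mpr h)
    omega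
  have hcond : W.conductorExponent (placeOf 3) = 2 := by
    rw [← hf]; exact (factorization_conductorNorm_primesEquiv_symm W ⟨3, Nat.prime_three⟩).symm
  have h2 : ringChar (ℤ ⧸ (placeOf 3).asIdeal) ≠ 2 := by rw [ringChar_int_quot_placeOf 3]; decide
  have hT := kodairaSymbolAt_of_conductorExponent_eq_two_of_three_mem (placeOf 3) W
    three_mem_maximalIdeal_adicCompletionIntegers_placeOf_three hcond
  have hord := W.ordMinimalDiscriminant_eq_numComponentsAt_add_one_of_kodairaSymbolAt (placeOf 3) h2 hT
  unfold numComponentsAt at hord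
  rcases hT with h | h | ⟨n, h⟩
  · left; refine ⟨h, ?_⟩; rw [hord, h]; rfl
  · right; left; refine ⟨h, ?_⟩; rw [hord, h]; rfl
  · right; right; refine ⟨n, h, ?_⟩; rw [hord, h, KodairaSymbol.numComponents_Istar]

/-- **`9 ∥ N` over `ℚ`, globally minimal equation: `ord₃ Δ_min ∈ {3, 9}` (types `III`, `III*`) or `ord₃ Δ_min = n + 6` (type `Iₙ*`),
and for `n ≥ 1` then `ord₃ j < 0`.**  So the POTENTIALLY GOOD tame curves at `3` (`ord₃ j ≥ 0`) are exactly the three strata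
`III` (`ord₃ Δ_min = 3`), `I₀*` (`6`), `III*` (`9`) of the cell's memos. [cite: SilvermanATAEC1994, IV.9.4 Table 4.1 and IV.11.1] -/
theorem padicValInt_three_minimalDiscriminantInt_of_nine_dvd_conductorNorm (W : WeierstrassCurve ℚ) [W.IsElliptic]
    [W.IsGloballyMinimal] (h9 : 3 ^ 2 ∣ W.conductorNorm ℤ) (h27 : ¬ 3 ^ 3 ∣ W.conductorNorm ℤ) :
    (W.kodairaSymbolAt (placeOf 3) = .III ∧ padicValInt 3 W.minimalDiscriminantInt = 3) ∨
      (W.kodairaSymbolAt (placeOf 3) = .Istar 0 ∧ padicValInt 3 W.minimalDiscriminantInt = 6) ∨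
      (W.kodairaSymbolAt (placeOf 3) = .IIIstar ∧ padicValInt 3 W.minimalDiscriminantInt = 9) ∨
      ∃ n, W.kodairaSymbolAt (placeOf 3) = .Istar (n + 1) ∧ padicValInt 3 W.minimalDiscriminantInt = n + 7 ∧
        padicValRat 3 W.j < 0 := by
  have hδ : W.ordMinimalDiscriminant (placeOf 3) = padicValInt 3 W.minimalDiscriminantInt :=
    ordMinimalDiscriminant_placeOf_eq W 3
  rcases kodairaSymbolAt_placeOf_three_of_nine_dvd_conductorNorm W h9 h27 with ⟨h, hd⟩ | ⟨h, hd⟩ | ⟨n, h, hd⟩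
  · left; exact ⟨h, by rw [← hδ, hd]⟩
  · right; right; left; exact ⟨h, by rw [← hδ, hd]⟩
  · cases n with
    | zero => right; left; exact ⟨h, by rw [← hδ, hd]⟩
    | succ n =>
      right; right; right
      refine ⟨n, h, by rw [← hδ, hd], ?_⟩
      haveI : PerfectField (IsLocalRing.ResidueField ((placeOf 3).adicCompletionIntegers ℚ)) := PerfectField.ofFinite
      have h2 : ringChar (ℤ ⧸ (placeOf 3).asIdeal) ≠ 2 := by rw [ringChar_int_quot_placeOf 3]; decide
      have hlt := W.one_lt_valuation_j_of_kodairaSymbolAt_eq_Istar_succ (placeOf 3) h2 h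
      have hgen : natGenerator (placeOf 3) = 3 :=
        congrArg Subtype.val ((primesEquiv (R := ℤ)).apply_symm_apply ⟨3, Nat.prime_three⟩)
      by_cases hj0 : W.j = 0
      · rw [hj0, map_zero] at hlt
        exact absurd hlt (not_lt_of_ge zero_le_one)
      rw [valuation_eq_exp_neg_padicValRat (placeOf 3) hj0, hgen,
        show (1 : WithZero (Multiplicative ℤ)) = WithZero.exp 0 from rfl, WithZero.exp_lt_exp] at hlt
      omega

/-- **The potentially good tame strata at `3`:** `9 ∥ N`, `ord₃ j ≥ 0` ⟹ `ord₃ Δ_min ∈ {3, 6, 9}`.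
[cite: SilvermanATAEC1994, IV.9.4 Table 4.1 and IV.11.1] -/
theorem padicValInt_three_minimalDiscriminantInt_of_nine_dvd_conductorNorm_of_j (W : WeierstrassCurve ℚ) [W.IsElliptic]
    [W.IsGloballyMinimal] (h9 : 3 ^ 2 ∣ W.conductorNorm ℤ) (h27 : ¬ 3 ^ 3 ∣ W.conductorNorm ℤ) (hj : 0 ≤ padicValRat 3 W.j) :
    padicValInt 3 W.minimalDiscriminantInt = 3 ∨ padicValInt 3 W.minimalDiscriminantInt = 6 ∨
      padicValInt 3 W.minimalDiscriminantInt = 9 := by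
  rcases padicValInt_three_minimalDiscriminantInt_of_nine_dvd_conductorNorm W h9 h27 with
    ⟨-, h⟩ | ⟨-, h⟩ | ⟨-, h⟩ | ⟨n, -, -, hneg⟩
  · exact Or.inl h
  · exact Or.inr (Or.inl h)
  · exact Or.inr (Or.inr h)
  · exact absurd hneg (not_lt.mpr hj)

end Rat

end Summit.BirchSwinnertonDyer.BirchSwinnertonDyer.Theorems.ManinLocalTwoThree

end
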